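import Literature.Geometry.Kaehler.RiemannSurfaceJacobianIdempotentRelations
import HarnessLib

/-!
# «We disregard the genus-`0` quotient»: Kani–Rosen's Theorem B and the Klein four-group relation with `g(X/G) = 0` —
# `J_X^{m−1} ∼ ∏ J_{X/H_i}^{h_i}`, `J_X ∼ J_{X/⟨a⟩} × J_{X/⟨b⟩} × J_{X/⟨ab⟩}`, and Paulhus' `J_X ∼ J_{X₁} × J_{X₂}`

Layer `Literature/Geometry/Kaehler`, lane `lit-hodgefound` (Track 2, seat p04, generation 53, row g53-#7). Sequel of
`RiemannSurfaceJacobianPullbackIsogeny` (g53-#1: Theorem B for curves as printed, `J_X^{m-1} × J_{X/G}^{|G|} ∼ ∏ J_{X/H_i}^{|H_i|}`)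
and `RiemannSurfaceJacobianIdempotentRelations` (g53-#2: `dim_ℚ Hom(S, Jac(M/H)) = χ_S(ε_H)`, Paulhus' (3)
`J_X × J_{X/G}² ∼ J_{X/⟨a⟩} × J_{X/⟨b⟩} × J_{X/⟨ab⟩}`). In the applications (Paulhus §3, Kani–Rosen's examples) the quotient
`X/G` is the projective line, and the factor `J_{X/G}` — a point — is dropped: «the quotient of `X` by this automorphism is a
genus `0` curve so we disregard it». This file makes the dropping a theorem: the Jacobian of a genus-`0` curve receives no
non-zero homomorphism (`Hom_ℚ(S, Jac N) = 0`), so the Hom-counts of Theorem B lose the `J_{X/G}` term.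

J. Paulhus, *Decomposing Jacobians of curves with extra automorphisms*, Acta Arith. 132 (2008), VERBATIM (held
`paper:doi-10-4064-aa132-3-3`): p. 233 «**Theorem 2** (Theorem B, [12]). Given a curve `X`, let `G ≤ Aut(X)` be a finite group
such that `G = H_1 ∪ ⋯ ∪ H_m` where the subgroups `H_i` satisfy `H_i ∩ H_j = 1_G` if `i ≠ j`. Then we have the following
isogeny relation: `J_X^{m−1} × J_{X/G}^g ∼ J_{X/H_1}^{h_1} × ⋯ × J_{X/H_m}^{h_m}` where `g = |G|` and `h_i = |H_i|`»; p. 234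
«(2) `J_X² × J⁴_{X/⟨a,b⟩} ∼ J²_{X/⟨a⟩} × J²_{X/⟨b⟩} × J²_{X/⟨ab⟩}`. […] we apply Poincaré's complete reducibility theorem to (2)
to get (3) `J_X × J²_{X/⟨a,b⟩} ∼ J_{X/⟨a⟩} × J_{X/⟨b⟩} × J_{X/⟨ab⟩}`»; p. 236 «**Theorem 5.** Any curve `X` of the form above
has a Jacobian that decomposes as `J_X ∼ J_{X_1} × J_{X_2}`. […] *Proof.* Applying Theorem 2 to the group `C_2 × C_2`
gives the following isogeny: (4) `J_X² ∼ J²_{X/⟨a⟩} × J²_{X/⟨b⟩} × J²_{X/⟨ab⟩}`. […] the first automorphism is the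
hyperelliptic involution and so the quotient of `X` by this automorphism is a genus `0` curve so we disregard it in (4) to
get `J_X ∼ J_{X_1} × J_{X_2}`, where `X_1 = X/⟨a⟩` and `X_2 = X/⟨ab⟩`.»

DICTIONARY. `X = M` compact connected Riemann surface (`M : Type`, the universe of the lane's relative files),
`G ≤ Aut M` finite (`G : Subgroup (autGroup M)`, `[Finite (autGroup M)]`), `X/H = OrbitSurface ↥(H.map G.subtype) M` for
`H ≤ ↥G`, `X/G = OrbitSurface ↥G M`; `J_X ≅ ℂ^g/Π ℤ^{2g}` (`Π = periodMatrix x₀ w c`), `J_{X/H}` in any bases `wH`, `cH`;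
`ρ_G = (jacobianRatAction x₀ w c).comp G.subtype`, `ε_G = groupAverage ρ_G`, `χ_S = homCharacter S Π`; `∼` = `IsIsogenous`,
products `prodPeriod` / `sigmaPiPeriod` / `powPeriod`; `kleinFourSubgroups a b = (⟨a⟩, ⟨b⟩, ⟨ab⟩)`.

## What is proved (theorems only; no definition, no instance, no named fact, no `sorry`)

* §1 ★ `finrank_homRat_jacobian_eq_zero_of_arithGenus_eq_zero` (`Hom_ℚ(S, Jac N) = 0` for `g(N) = 0`: the lattice of
  `Jac N` has rank `0`), `natCast_finrank_homRat_idemPeriod_groupAverage_eq_zero` (`dim Hom(S, J_X^{ε_G}) = 0` when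
  `g(X/G) = 0`: `ε_G = 0`).
* §2 ★★ **`isIsogenous_pow_jacobian_sigmaPi_of_arithGenus_eq_zero`: THEOREM B WITH `g(X/G) = 0`,
  `J_X^{m−1} ∼ J_{X/H_1}^{h_1} × ⋯ × J_{X/H_m}^{h_m}`** (Paulhus' (4) is the case `G = C_2 × C_2`).
* §3 ★★ **`isIsogenous_jacobian_sigmaPi_orbitSurface_kleinFour_of_arithGenus_eq_zero`: `J_X ∼ J_{X/⟨a⟩} × J_{X/⟨b⟩} × J_{X/⟨ab⟩}`
  for `G = ⟨a, b⟩ ≅ C_2 × C_2` with `g(X/G) = 0`** ((3) with the genus-`0` factor disregarded), and ★★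
  **`isIsogenous_jacobian_prod_orbitSurface_kleinFour_of_arithGenus_eq_zero`: `J_X ∼ J_{X/⟨a⟩} × J_{X/⟨ab⟩}` when moreover
  `g(X/⟨b⟩) = 0`** (Theorem 5's «`J_X ∼ J_{X_1} × J_{X_2}`», `b` the hyperelliptic involution).

## References

* J. Paulhus, *Decomposing Jacobians of curves with extra automorphisms*, Acta Arith. 132 (2008), 231–244: p. 233
  Theorem 2; p. 234 (2)–(3); p. 236 Theorem 5 and (4). [Paulhus2008]
* E. Kani, M. Rosen, *Idempotent relations and factors of Jacobians*, Math. Ann. 284 (1989), 307–327, Theorems B, C.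
  [KaniRosen1989]
* H. Lange, *Abelian Varieties over the Complex Numbers*, Springer (2023), §2.4.4 Theorem 2.4.25, Corollary 2.4.26
  (Poincaré: `Hom`-counts). [Lange2023AbelianVarietiesComplex]
* H. Lange, R. E. Rodríguez, *Decomposition of Jacobians by Prym Varieties*, LNM 2310 (2022), §3.2.1 Remark 3.2.5
  («If `g = 0`, then `P(f) = J̃`»). [LangeRodriguez2022]
-/

noncomputable section

open scoped Manifold ContDiff Topology
open Set Function Module Submodule Matrix
open Literature.RepresentationTheory.FiniteGroups

namespace Literature.Geometry.Kaehler

namespace RiemannSurface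

open ComplexTorus MeromorphicOneForm

universe u u₁

/-! ### §1 `Hom_ℚ(S, Jac N) = 0` for a curve `N` of genus `0` -/

section GenusZero

variable {N : Type u} [TopologicalSpace N] [ChartedSpace ℂ N] [ConnectedSpace N] [IsManifold 𝓘(ℂ, ℂ) ω N]
  [CompactSpace N] [T2Space N] (y₀ : N)
  {σ' : Type*} [Fintype σ'] [DecidableEq σ'] (w' : Module.Basis σ' ℂ ↥(holomorphicOneForms N))
  {κ' : Type*} [Fintype κ'] [DecidableEq κ'] (c' : Module.Basis κ' ℤ ↥(periods y₀))
  {ι₀ : Type*} [Fintype ι₀] [DecidableEq ι₀] {E₀ : Type*} [NormedAddCommGroup E₀] [NormedSpace ℂ E₀]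
  (S : (ι₀ → ℝ) ≃L[ℝ] E₀)

/-- ★ **`Hom_ℚ(S, Jac N) = 0` when `g(N) = 0`**: the period lattice of a genus-`0` curve has rank `2g = 0`, so the rational
representations `Hom_ℚ(S, Jac N) ⊂ M(0 × 2 dim S, ℚ)` vanish («the quotient … is a genus `0` curve so we disregard it»).
[cite: Paulhus2008, p. 236 (proof of Theorem 5)] [cite: LangeRodriguez2022, §3.2.1 Remark 3.2.5] -/
theorem finrank_homRat_jacobian_eq_zero_of_arithGenus_eq_zero (h0 : arithGenus N = 0) :
    finrank ℚ (homRat S (periodMatrix y₀ w' c')) = 0 := by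
  haveI : IsEmpty κ' := Fintype.card_eq_zero_iff.1 (by rw [fintypeCard_eq_two_mul_arithGenus y₀ c', h0])
  exact Module.finrank_zero_of_subsingleton

end GenusZero

section Quotients

variable {M : Type} [TopologicalSpace M] [ChartedSpace ℂ M] [ConnectedSpace M] [IsManifold 𝓘(ℂ, ℂ) ω M]
  [CompactSpace M] [T2Space M] [IsManifold 𝓘(ℝ, ℂ) ∞ M] [Fact (Module.finrank ℝ ℂ = 2)] [Finite (autGroup M)]
  (G : Subgroup (autGroup M)) [Fintype ↥G] (x₀ : M)
  {σ : Type u₁} [Fintype σ] [DecidableEq σ] (w : Module.Basis σ ℂ ↥(holomorphicOneForms M))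
  {κ : Type*} [Fintype κ] [DecidableEq κ] (c : Module.Basis κ ℤ ↥(periods x₀))
  {ι₀ : Type*} [Fintype ι₀] [DecidableEq ι₀] {E₀ : Type u₁} [NormedAddCommGroup E₀] [NormedSpace ℂ E₀]

omit [IsManifold 𝓘(ℝ, ℂ) ∞ M] [Fact (Module.finrank ℝ ℂ = 2)] in
/-- **`dim_ℚ Hom(S, J_X^{ε_G}) = 0` when `g(X/G) = 0`** (`ε_G = 0` in `End_ℚ(J_X)` iff `g(X/G) = 0`, generation 52).
[cite: Paulhus2008, p. 236 (proof of Theorem 5)] [cite: LangeRodriguez2022, §3.2.1 Remark 3.2.5] -/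
theorem natCast_finrank_homRat_idemPeriod_groupAverage_eq_zero (h0 : arithGenus (OrbitSurface ↥G M) = 0)
    (S : (ι₀ → ℝ) ≃L[ℝ] E₀) :
    (finrank ℚ (homRat S (idemPeriod (periodMatrix x₀ w c) (groupAverage ((jacobianRatAction x₀ w c).comp G.subtype)))) : ℚ)
      = 0 := by
  rw [← homCharacter_eq_finrank S (periodMatrix x₀ w c) (isIdempotentElem_groupAverage _),
    (groupAverage_jacobian_eq_zero_iff G x₀ w c).2 h0, map_zero]

/-! ### §2 Theorem B with `g(X/G) = 0`: `J_X^{m−1} ∼ ∏ J_{X/H_i}^{h_i}` -/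

/-- ★★ **THEOREM B WITH `g(X/G) = 0`: `J_X^{m−1} ∼ J_{X/H_1}^{h_1} × ⋯ × J_{X/H_m}^{h_m}`** for `G = H_1 ∪ ⋯ ∪ H_m ≤ Aut X` with
`H_i ∩ H_j = 1` (`i ≠ j`) and `X/G ≅ ℙ¹` — Theorem 2's relation with the genus-`0` factor `J_{X/G}^{|G|}` disregarded (both sides
are abelian varieties with the same `Hom`-counts: `(m − 1) dim Hom(S, J_X) + |G| · 0 = Σ h_i dim Hom(S, J_{X/H_i})`).
Paulhus' (4) `J_X² ∼ J²_{X/⟨a⟩} × J²_{X/⟨b⟩} × J²_{X/⟨ab⟩}` is the case `G = C_2 × C_2`. [cite: Paulhus2008, p. 233 Theorem 2, p. 236 (4)] [cite: KaniRosen1989, Theorem B] [cite: Lange2023AbelianVarietiesComplex, §2.4.4 Theorem 2.4.25, Corollary 2.4.26] -/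
theorem isIsogenous_pow_jacobian_sigmaPi_of_arithGenus_eq_zero [DecidableEq ↥G] {m : ℕ} (H : Fin m → Subgroup ↥G)
    [∀ i, Fintype ↥(H i)] [∀ i, DecidablePred (· ∈ H i)] [∀ i, Fintype ↥((H i).map G.subtype)]
    (hcover : ∀ g, ∃ i, g ∈ H i) (hdisj : ∀ i j, i ≠ j → ∀ g, g ∈ H i → g ∈ H j → g = 1)
    (h0 : arithGenus (OrbitSurface ↥G M) = 0)
    {τ : Fin m → Type u₁} [∀ i, Fintype (τ i)] [∀ i, DecidableEq (τ i)]
    (wH : ∀ i, Module.Basis (τ i) ℂ ↥(holomorphicOneForms (OrbitSurface ↥((H i).map G.subtype) M)))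
    {κH : Fin m → Type*} [∀ i, Fintype (κH i)] [∀ i, DecidableEq (κH i)]
    (cH : ∀ i, Module.Basis (κH i) ℤ ↥(periods (OrbitSurface.mk ↥((H i).map G.subtype) x₀))) :
    IsIsogenous (powPeriod (periodMatrix x₀ w c) (m - 1))
      (sigmaPiPeriod fun i ↦
        powPeriod (periodMatrix (OrbitSurface.mk ↥((H i).map G.subtype) x₀) (wH i) (cH i)) (Fintype.card ↥(H i))) := by
  have hX := isAbelianVariety_jacobian w x₀ c
  have hH := fun i ↦ isAbelianVariety_jacobian_orbitSurface x₀ _ (wH i) (cH i)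
  refine (hX.pow _).isIsogenous_of_forall_finrank_homRat_eq (IsAbelianVariety.sigmaPi fun i ↦ (hH i).pow _)
    fun k E₀ _ _ S _ ↦ ?_
  have key := finrank_homRat_kaniRosenB_eq (periodMatrix x₀ w c) ((jacobianRatAction x₀ w c).comp G.subtype) H
    hcover hdisj S
  have hG0 : finrank ℚ (homRat S (idemPeriod (periodMatrix x₀ w c)
      (groupAverage ((jacobianRatAction x₀ w c).comp G.subtype)))) = 0 := by
    exact_mod_cast natCast_finrank_homRat_idemPeriod_groupAverage_eq_zero G x₀ w c h0 S
  have hHi : ∀ i, finrank ℚ (homRat S (idemPeriod (periodMatrix x₀ w c)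
      (subgroupAverage ((jacobianRatAction x₀ w c).comp G.subtype) (H i)))) =
        finrank ℚ (homRat S (periodMatrix (OrbitSurface.mk ↥((H i).map G.subtype) x₀) (wH i) (cH i))) :=
    fun i ↦ ((isIsogenous_jacobian_orbitSurface_idemPeriod_subgroupAverage G x₀ w c (H i) (wH i)
      (cH i)).finrank_homRat_eq_right S).symm
  rw [hG0, mul_zero, add_zero] at key
  simp only [hHi] at key
  rw [finrank_homRat_powPeriod_right, finrank_homRat_sigmaPiPeriod_right, key]
  exact Finset.sum_congr rfl fun i _ ↦ (finrank_homRat_powPeriod_right S _ _).symm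

/-! ### §3 The Klein four-group with `X/G ≅ ℙ¹` -/

/-- ★★ **`J_X ∼ J_{X/⟨a⟩} × J_{X/⟨b⟩} × J_{X/⟨ab⟩}` for `G = ⟨a, b⟩ ≅ C_2 × C_2 ≤ Aut X` with `g(X/G) = 0`** — Paulhus' (3)
`J_X × J²_{X/⟨a,b⟩} ∼ J_{X/⟨a⟩} × J_{X/⟨b⟩} × J_{X/⟨ab⟩}` with the genus-`0` factor disregarded: the idempotent relation
`1 + 2ε_G = ε_{⟨a⟩} + ε_{⟨b⟩} + ε_{⟨ab⟩}` with `ε_G = 0` reads `1 = ε_{⟨a⟩} + ε_{⟨b⟩} + ε_{⟨ab⟩}`, and `χ_S(ε_H) = dim Hom(S, J_{X/H})`.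
[cite: Paulhus2008, p. 234 (2)–(3), p. 236 (4) and proof of Theorem 5] [cite: KaniRosen1989, Theorems B, C] -/
theorem isIsogenous_jacobian_sigmaPi_orbitSurface_kleinFour_of_arithGenus_eq_zero [IsKleinFour ↥G] {x y : ↥G} (hx : x ≠ 1)
    (hy : y ≠ 1) (hxy : x ≠ y) [∀ i, Fintype ↥((kleinFourSubgroups x y i).map G.subtype)]
    (h0 : arithGenus (OrbitSurface ↥G M) = 0)
    {τ : Fin 3 → Type u₁} [∀ i, Fintype (τ i)] [∀ i, DecidableEq (τ i)]
    (wH : ∀ i, Module.Basis (τ i) ℂ ↥(holomorphicOneForms (OrbitSurface ↥((kleinFourSubgroups x y i).map G.subtype) M)))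
    {κH : Fin 3 → Type*} [∀ i, Fintype (κH i)] [∀ i, DecidableEq (κH i)]
    (cH : ∀ i, Module.Basis (κH i) ℤ ↥(periods (OrbitSurface.mk ↥((kleinFourSubgroups x y i).map G.subtype) x₀))) :
    IsIsogenous (periodMatrix x₀ w c)
      (sigmaPiPeriod fun i : Fin 3 ↦
        periodMatrix (OrbitSurface.mk ↥((kleinFourSubgroups x y i).map G.subtype) x₀) (wH i) (cH i)) := by
  have hX := isAbelianVariety_jacobian w x₀ c
  have hH := fun i ↦ isAbelianVariety_jacobian_orbitSurface x₀ _ (wH i) (cH i)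
  refine hX.isIsogenous_of_forall_finrank_homRat_eq (IsAbelianVariety.sigmaPi hH) fun k E₀ _ _ S _ ↦ ?_
  -- (2): `p_{⟨a⟩} + p_{⟨b⟩} + p_{⟨ab⟩} = 1 + 2 p_G` in `ℚ[G]`, through `χ_S ∘ ρ̄_G`, with `ε_G = ρ̄_G(p_G) = 0`
  have hε : groupAverage ((jacobianRatAction x₀ w c).comp G.subtype) = 0 := (groupAverage_jacobian_eq_zero_iff G x₀ w c).2 h0
  have key := congrArg (fun z ↦ homCharacter S (periodMatrix x₀ w c)
    (groupAlgebraRep ((jacobianRatAction x₀ w c).comp G.subtype) z)) (sum_subgroupIdempotent_kleinFour hx hy hxy)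
  simp only [map_add, map_smul, map_one, smul_eq_mul] at key
  rw [homCharacter_one, groupAlgebraRep_subgroupIdempotent_top, hε, map_zero, mul_zero, add_zero] at key
  have h0' : (finrank ℚ (homRat S (periodMatrix (OrbitSurface.mk ↥((kleinFourSubgroups x y 0).map G.subtype) x₀)
      (wH 0) (cH 0))) : ℚ) = homCharacter S (periodMatrix x₀ w c)
        (groupAlgebraRep ((jacobianRatAction x₀ w c).comp G.subtype) (subgroupIdempotent (Subgroup.zpowers x))) :=
    natCast_finrank_homRat_jacobian_orbitSurface G x₀ w c (kleinFourSubgroups x y 0) (wH 0) (cH 0) S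
  have h1 : (finrank ℚ (homRat S (periodMatrix (OrbitSurface.mk ↥((kleinFourSubgroups x y 1).map G.subtype) x₀)
      (wH 1) (cH 1))) : ℚ) = homCharacter S (periodMatrix x₀ w c)
        (groupAlgebraRep ((jacobianRatAction x₀ w c).comp G.subtype) (subgroupIdempotent (Subgroup.zpowers y))) :=
    natCast_finrank_homRat_jacobian_orbitSurface G x₀ w c (kleinFourSubgroups x y 1) (wH 1) (cH 1) S
  have h2 : (finrank ℚ (homRat S (periodMatrix (OrbitSurface.mk ↥((kleinFourSubgroups x y 2).map G.subtype) x₀)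
      (wH 2) (cH 2))) : ℚ) = homCharacter S (periodMatrix x₀ w c)
        (groupAlgebraRep ((jacobianRatAction x₀ w c).comp G.subtype) (subgroupIdempotent (Subgroup.zpowers (x * y)))) :=
    natCast_finrank_homRat_jacobian_orbitSurface G x₀ w c (kleinFourSubgroups x y 2) (wH 2) (cH 2) S
  rw [finrank_homRat_sigmaPiPeriod_right, Fin.sum_univ_three]
  rw [← h0', ← h1, ← h2] at key
  exact_mod_cast key.symm

/-- ★★ **THEOREM 5's «`J_X ∼ J_{X_1} × J_{X_2}`, `X_1 = X/⟨a⟩`, `X_2 = X/⟨ab⟩`»** for `G = ⟨a, b⟩ ≅ C_2 × C_2 ≤ Aut X` with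
`g(X/G) = 0` and `g(X/⟨b⟩) = 0` (`b` the hyperelliptic involution: «the quotient of `X` by this automorphism is a genus `0` curve
so we disregard it in (4)»): `1 = ε_{⟨a⟩} + ε_{⟨b⟩} + ε_{⟨ab⟩}` with `χ_S(ε_{⟨b⟩}) = 0`. [cite: Paulhus2008, p. 236 Theorem 5 and its proof] [cite: KaniRosen1989, Theorem C] -/
theorem isIsogenous_jacobian_prod_orbitSurface_kleinFour_of_arithGenus_eq_zero [IsKleinFour ↥G] {x y : ↥G} (hx : x ≠ 1)
    (hy : y ≠ 1) (hxy : x ≠ y) [Fintype ↥((Subgroup.zpowers x).map G.subtype)] [Fintype ↥((Subgroup.zpowers y).map G.subtype)]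
    [Fintype ↥((Subgroup.zpowers (x * y)).map G.subtype)]
    (h0 : arithGenus (OrbitSurface ↥G M) = 0) (hy0 : arithGenus (OrbitSurface ↥((Subgroup.zpowers y).map G.subtype) M) = 0)
    {σ₁ : Type u₁} [Fintype σ₁] [DecidableEq σ₁]
    (w₁ : Module.Basis σ₁ ℂ ↥(holomorphicOneForms (OrbitSurface ↥((Subgroup.zpowers x).map G.subtype) M)))
    {κ₁ : Type*} [Fintype κ₁] [DecidableEq κ₁]
    (c₁ : Module.Basis κ₁ ℤ ↥(periods (OrbitSurface.mk ↥((Subgroup.zpowers x).map G.subtype) x₀)))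
    {σ₂ : Type u₁} [Fintype σ₂] [DecidableEq σ₂]
    (w₂ : Module.Basis σ₂ ℂ ↥(holomorphicOneForms (OrbitSurface ↥((Subgroup.zpowers (x * y)).map G.subtype) M)))
    {κ₂ : Type*} [Fintype κ₂] [DecidableEq κ₂]
    (c₂ : Module.Basis κ₂ ℤ ↥(periods (OrbitSurface.mk ↥((Subgroup.zpowers (x * y)).map G.subtype) x₀))) :
    IsIsogenous (periodMatrix x₀ w c)
      (prodPeriod (periodMatrix (OrbitSurface.mk ↥((Subgroup.zpowers x).map G.subtype) x₀) w₁ c₁)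
        (periodMatrix (OrbitSurface.mk ↥((Subgroup.zpowers (x * y)).map G.subtype) x₀) w₂ c₂)) := by
  have hX := isAbelianVariety_jacobian w x₀ c
  refine hX.isIsogenous_of_forall_finrank_homRat_eq
    ((isAbelianVariety_jacobian_orbitSurface x₀ _ w₁ c₁).prod (isAbelianVariety_jacobian_orbitSurface x₀ _ w₂ c₂))
    fun k E₀ _ _ S _ ↦ ?_
  have hε : groupAverage ((jacobianRatAction x₀ w c).comp G.subtype) = 0 := (groupAverage_jacobian_eq_zero_iff G x₀ w c).2 h0
  have hεy : groupAlgebraRep ((jacobianRatAction x₀ w c).comp G.subtype) (subgroupIdempotent (Subgroup.zpowers y)) = 0 :=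
    (groupAlgebraRep_subgroupIdempotent_jacobian_eq_zero_iff G x₀ w c (Subgroup.zpowers y)).2 hy0
  have key := congrArg (fun z ↦ homCharacter S (periodMatrix x₀ w c)
    (groupAlgebraRep ((jacobianRatAction x₀ w c).comp G.subtype) z)) (sum_subgroupIdempotent_kleinFour hx hy hxy)
  simp only [map_add, map_smul, map_one, smul_eq_mul] at key
  rw [homCharacter_one, groupAlgebraRep_subgroupIdempotent_top, hε, hεy, map_zero, mul_zero, add_zero, add_zero,
    ← natCast_finrank_homRat_jacobian_orbitSurface G x₀ w c (Subgroup.zpowers x) w₁ c₁ S,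
    ← natCast_finrank_homRat_jacobian_orbitSurface G x₀ w c (Subgroup.zpowers (x * y)) w₂ c₂ S] at key
  rw [finrank_homRat_prod_right]
  exact_mod_cast key.symm

end Quotients

end RiemannSurface

end Literature.Geometry.Kaehler
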